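import Literature.Probability.LatticeModels.MeanFieldDifferentialInequality
import HarnessLib

/-!
# Transport of currents on the ghost graph along a graph automorphism (translation invariance of current sums)

Topic `Probability/LatticeModels`, namespace `Literature.Probability.LatticeModels`. Sequel of
`FieldCurrents` / `MeanFieldDifferentialInequality`.

An automorphism `φ : V ≃ V` of the graph `G` that preserves the finite volume `Λ` and the
couplings `θ` acts on the ghost graph `ghostGraph G Λ` (by `Option.map φ`, fixing the ghost), on
its edges `ℰ⁺_Λ`, and hence on currents `n : ℰ⁺_Λ → ℕ` by transport of structure. This file
records that every ingredient of the random-current sums of the previous files is covariant: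
weights (`gweight_ctransport`), degrees and sources (`cdeg_ctransport`, `csources_ctransport`),
connections (`cconn_ctransport`), cluster complements (`clusterCompl_ctransport`), and therefore
the pair sums `currentPairSum` with transported sources and functionals (`currentPairSum_map`); in
particular the law of the set `𝒮_g` of vertices not connected to the ghost in the duplicated
sourceless system is invariant (`dctW_map`). On the discrete torus with its translations this is
the translation invariance used by Aizenman–Fernández 1986 in the averaging identity (5.12) and
in the proof of Lemma 5.3 ("if `f(x+a, y+a, z+a) = f(x,y,z)` … then
`∑_{y,z} f(x,y,z) = ∑_{y,z} f(y,x,z)`"), there applied to functions defined through random currents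
(`dctW_torus_add`).

## References

* M. Aizenman, R. Fernández, J. Stat. Phys. **44** (1986) 393–454, §5.1, eq. (5.12) and the proof
  of Lemma 5.3, p. 427 [AizenmanFernandezJSP1986].
* S. Friedli, Y. Velenik, *Statistical Mechanics of Lattice Systems*, CUP 2017, §3.1 (periodic
  boundary condition; invariance under the symmetries of the torus) [FriedliVelenik2017].

## Mathlib

`Equiv.optionCongr`, `Sym2.map`, `Sym2.mem_map`, `Sym2.map_map`, `Equiv.arrowCongr`,
`Equiv.tsum_eq`, `Fintype.prod_equiv`, `Fintype.sum_equiv`, `Relation.ReflTransGen.lift`.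
-/

noncomputable section

open Finset MeasureTheory
open scoped symmDiff ENNReal

namespace Literature.Probability.LatticeModels

variable {V : Type*} [DecidableEq V]

section Transport

variable {G : SimpleGraph V} [G.LocallyFinite] {Λ : Finset V}

local notation "Gg" => ghostGraph G Λ
local notation "Λg" => Finset.insertNone Λ
local notation "Eg" => edgesIn (ghostGraph G Λ) (Finset.insertNone Λ)
local notation "Conn[" m ", " u ", " v "]" =>
  CConn (ghostGraph G Λ) (Finset.insertNone Λ) m (edgesIn (ghostGraph G Λ) (Finset.insertNone Λ)) u v
local notation "∂g" => csources (ghostGraph G Λ) (Finset.insertNone Λ)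
local notation "𝒮[" m ", " b "]" => clusterCompl (ghostGraph G Λ) (Finset.insertNone Λ) m b

/-- **A volume-preserving automorphism** of `(G, Λ)`: a permutation of the vertices preserving
adjacency and the finite volume. [folklore] -/
structure VolAut (G : SimpleGraph V) (Λ : Finset V) where
  /-- the underlying permutation -/
  toEquiv : V ≃ V
  /-- it preserves adjacency -/
  adj_iff : ∀ x y, G.Adj (toEquiv x) (toEquiv y) ↔ G.Adj x y
  /-- it preserves the volume -/
  mem_iff : ∀ x, toEquiv x ∈ Λ ↔ x ∈ Λ

variable (φ : VolAut G Λ)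

/-- The lift `φ̂ = Option.map φ` to the ghost vertex type (the ghost is fixed). [folklore] -/
def VolAut.lift : Option V ≃ Option V := Equiv.optionCongr φ.toEquiv

omit [DecidableEq V] [G.LocallyFinite] in
/-- The lift fixes the ghost. [folklore] -/
@[simp] theorem VolAut.lift_none : φ.lift none = none := rfl

omit [DecidableEq V] [G.LocallyFinite] in
/-- The lift on real vertices. [folklore] -/
@[simp] theorem VolAut.lift_some (x : V) : φ.lift (some x) = some (φ.toEquiv x) := rfl

/-- The lift as an embedding. [folklore] -/
def VolAut.liftEmb : Option V ↪ Option V := φ.lift.toEmbedding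

omit [DecidableEq V] [G.LocallyFinite] in
/-- The embedding is the lift. [folklore] -/
@[simp] theorem VolAut.liftEmb_apply (v : Option V) : φ.liftEmb v = φ.lift v := rfl

omit [DecidableEq V] [G.LocallyFinite] in
/-- `Sym2.map` along the inverse undoes `Sym2.map`. [folklore] -/
theorem VolAut.sym2_map_symm_map (e : Sym2 (Option V)) : Sym2.map φ.lift.symm (Sym2.map φ.lift e) = e := by
  rw [Sym2.map_map, Equiv.symm_comp_self, Sym2.map_id, id]

omit [DecidableEq V] [G.LocallyFinite] in
/-- `Sym2.map` undoes `Sym2.map` along the inverse. [folklore] -/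
theorem VolAut.sym2_map_map_symm (e : Sym2 (Option V)) : Sym2.map φ.lift (Sym2.map φ.lift.symm e) = e := by
  rw [Sym2.map_map, Equiv.self_comp_symm, Sym2.map_id, id]

omit [DecidableEq V] [G.LocallyFinite] in
/-- The lift preserves adjacency in the ghost graph. [folklore] -/
theorem VolAut.ghost_adj_iff (a b : Option V) : (Gg).Adj (φ.lift a) (φ.lift b) ↔ (Gg).Adj a b := by
  cases a with
  | none =>
    cases b with
    | none => simp
    | some y => simp [φ.mem_iff]
  | some x =>
    cases b with
    | none => simp [φ.mem_iff]
    | some y => simp [φ.adj_iff]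

omit [DecidableEq V] [G.LocallyFinite] in
/-- The lift preserves membership in `Λ ∪ {g}`. [folklore] -/
theorem VolAut.mem_insertNone_iff (v : Option V) : φ.lift v ∈ Λg ↔ v ∈ Λg := by
  cases v with
  | none => simp [Finset.mem_insertNone]
  | some x => simp [Finset.mem_insertNone, φ.mem_iff]

/-- The image of an edge of `ℰ⁺_Λ` is an edge of `ℰ⁺_Λ`. [folklore] -/
theorem VolAut.map_mem_edgesIn_iff (e : Sym2 (Option V)) : Sym2.map φ.lift e ∈ Eg ↔ e ∈ Eg := by
  induction e using Sym2.ind with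
  | _ a b =>
    simp only [Sym2.map_mk, mem_edgesIn_iff, SimpleGraph.mem_edgeSet, Sym2.mem_iff,
      forall_eq_or_imp, forall_eq, φ.ghost_adj_iff, φ.mem_insertNone_iff]

/-- **The action on the edges `ℰ⁺_Λ`.** [folklore] -/
def VolAut.edgeEquiv : Eg ≃ Eg where
  toFun e := ⟨Sym2.map φ.lift e, (φ.map_mem_edgesIn_iff e).2 e.2⟩
  invFun e := ⟨Sym2.map φ.lift.symm e, by
    have := (φ.map_mem_edgesIn_iff (Sym2.map φ.lift.symm (e : Sym2 (Option V)))).1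
    rw [φ.sym2_map_map_symm] at this
    exact this e.2⟩
  left_inv e := Subtype.ext (φ.sym2_map_symm_map e)
  right_inv e := Subtype.ext (φ.sym2_map_map_symm e)

/-- The edge action is `Sym2.map φ̂`. [folklore] -/
@[simp] theorem VolAut.coe_edgeEquiv (e : Eg) : ((φ.edgeEquiv e : Eg) : Sym2 (Option V)) = Sym2.map φ.lift e := rfl

omit [DecidableEq V] [G.LocallyFinite] in
/-- Membership of a lifted vertex in a mapped edge. [folklore] -/
theorem VolAut.lift_mem_map_iff (v : Option V) (e : Sym2 (Option V)) : φ.lift v ∈ Sym2.map φ.lift e ↔ v ∈ e := by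
  rw [Sym2.mem_map]
  constructor
  · rintro ⟨w, hw, hwv⟩
    rwa [← φ.lift.injective hwv]
  · exact fun h => ⟨v, h, rfl⟩

/-- **Transport of currents**: `(φ • n)(φ e) = n(e)`. [folklore] -/
def VolAut.ctransport : (Eg → ℕ) ≃ (Eg → ℕ) := Equiv.arrowCongr φ.edgeEquiv (Equiv.refl ℕ)

/-- `(φ • n)(e) = n(φ⁻¹ e)`. [folklore] -/
theorem VolAut.ctransport_apply (n : Eg → ℕ) (e : Eg) : φ.ctransport n e = n (φ.edgeEquiv.symm e) := rfl

/-- `(φ • n)(φ e) = n(e)`. [folklore] -/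
@[simp] theorem VolAut.ctransport_apply_edgeEquiv (n : Eg → ℕ) (e : Eg) : φ.ctransport n (φ.edgeEquiv e) = n e := by
  rw [VolAut.ctransport_apply, Equiv.symm_apply_apply]

/-- Transport is additive. [folklore] -/
theorem VolAut.ctransport_add (n₁ n₂ : Eg → ℕ) : φ.ctransport (n₁ + n₂) = φ.ctransport n₁ + φ.ctransport n₂ := by
  funext e; rfl

/-- **Invariant couplings give invariant weights**: `w_θ(φ • n) = w_θ(n)` if `θ ∘ φ = θ` on `ℰ⁺_Λ`. [folklore] -/
theorem VolAut.gweight_ctransport {θ : Sym2 (Option V) → ℝ} (hθ : ∀ e : Eg, θ (Sym2.map φ.lift e) = θ e)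
    (n : Eg → ℕ) : gweight Gg Λg θ (φ.ctransport n) = gweight Gg Λg θ n := by
  unfold gweight
  rw [← Fintype.prod_equiv φ.edgeEquiv (fun e => edgeWeight (θ e) (n e))
    (fun e => edgeWeight (θ e) (φ.ctransport n e))]
  intro e
  rw [VolAut.ctransport_apply_edgeEquiv, VolAut.coe_edgeEquiv, hθ]

/-- Degrees are transported: `deg_{φ•n}(φ v) = deg_n(v)`. [folklore] -/
theorem VolAut.cdeg_ctransport (n : Eg → ℕ) (v : Option V) :
    cdeg Gg Λg (φ.ctransport n) (φ.lift v) = cdeg Gg Λg n v := by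
  unfold cdeg
  rw [← Fintype.sum_equiv φ.edgeEquiv (fun e => if v ∈ (e : Sym2 (Option V)) then n e else 0)
    (fun e => if φ.lift v ∈ (e : Sym2 (Option V)) then φ.ctransport n e else 0)]
  intro e
  simp only [VolAut.ctransport_apply_edgeEquiv, VolAut.coe_edgeEquiv, φ.lift_mem_map_iff]

/-- Sources are transported: `∂(φ • n) = φ(∂n)`. [folklore] -/
theorem VolAut.csources_ctransport (n : Eg → ℕ) : ∂g (φ.ctransport n) = (∂g n).map φ.liftEmb := by
  ext v
  simp only [csources, mem_filter, mem_map, VolAut.liftEmb_apply]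
  constructor
  · rintro ⟨hv, hodd⟩
    refine ⟨φ.lift.symm v, ⟨?_, ?_⟩, by simp⟩
    · have := (φ.mem_insertNone_iff (φ.lift.symm v)).1
      rw [Equiv.apply_symm_apply] at this
      exact this hv
    · have := φ.cdeg_ctransport n (φ.lift.symm v)
      rw [Equiv.apply_symm_apply] at this
      rwa [← this]
  · rintro ⟨w, ⟨hw, hodd⟩, rfl⟩
    exact ⟨(φ.mem_insertNone_iff w).2 hw, by rwa [φ.cdeg_ctransport]⟩

/-- Connections are transported (one direction). [folklore] -/
theorem VolAut.cconn_ctransport_of (m : Eg → ℕ) {u v : Option V} (h : Conn[m, u, v]) :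
    Conn[φ.ctransport m, φ.lift u, φ.lift v] := by
  induction h with
  | refl => exact Relation.ReflTransGen.refl
  | tail _ hbc ih =>
    obtain ⟨e, he, hpos, hes⟩ := hbc
    refine ih.tail ⟨φ.edgeEquiv e, (φ.edgeEquiv e).2, by rwa [VolAut.ctransport_apply_edgeEquiv], ?_⟩
    rw [VolAut.coe_edgeEquiv, hes, Sym2.map_mk]

/-- **Connections are transported**: `φ u ↔ φ v` in `φ • m` iff `u ↔ v` in `m`. [folklore] -/
theorem VolAut.cconn_ctransport (m : Eg → ℕ) (u v : Option V) :
    Conn[φ.ctransport m, φ.lift u, φ.lift v] ↔ Conn[m, u, v] := by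
  refine ⟨fun h => ?_, φ.cconn_ctransport_of m⟩
  -- apply the one-directional statement to the inverse automorphism
  let ψ : VolAut G Λ := ⟨φ.toEquiv.symm, fun x y => by
    have := φ.adj_iff (φ.toEquiv.symm x) (φ.toEquiv.symm y)
    rw [Equiv.apply_symm_apply, Equiv.apply_symm_apply] at this
    exact this.symm, fun x => by
    have := φ.mem_iff (φ.toEquiv.symm x)
    rw [Equiv.apply_symm_apply] at this
    exact this.symm⟩
  have hψ : ∀ w : Option V, ψ.lift (φ.lift w) = w := fun w => by
    cases w <;> simp [ψ, VolAut.lift, Equiv.optionCongr]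
  have hlift : ∀ w : Option V, ψ.lift w = φ.lift.symm w := fun w => by
    cases w <;> rfl
  have hct : ψ.ctransport (φ.ctransport m) = m := by
    funext e
    rw [VolAut.ctransport_apply, VolAut.ctransport_apply]
    congr 1
    apply Subtype.ext
    simp only [VolAut.edgeEquiv, Equiv.coe_fn_symm_mk, Sym2.map_map]
    have hcomp : (⇑φ.lift.symm ∘ ⇑ψ.lift.symm) = id := by
      funext w
      have : ψ.lift.symm w = φ.lift w := by
        rw [Equiv.symm_apply_eq, hlift, Equiv.symm_apply_apply]
      simp [this]
    rw [hcomp, Sym2.map_id, id]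
  have := ψ.cconn_ctransport_of (φ.ctransport m) h
  rwa [hψ, hψ, hct] at this

/-- **Cluster complements are transported**: `𝒮_{φ b}(φ • m) = φ(𝒮_b(m))`. [folklore] -/
theorem VolAut.clusterCompl_ctransport (m : Eg → ℕ) (b : Option V) :
    𝒮[φ.ctransport m, φ.lift b] = (𝒮[m, b]).map φ.liftEmb := by
  ext v
  simp only [mem_clusterCompl, mem_map, VolAut.liftEmb_apply]
  constructor
  · rintro ⟨hv, hnc⟩
    refine ⟨φ.lift.symm v, ⟨?_, fun hc => hnc ?_⟩, by simp⟩
    · have := (φ.mem_insertNone_iff (φ.lift.symm v)).1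
      rw [Equiv.apply_symm_apply] at this
      exact this hv
    · have := (φ.cconn_ctransport m b (φ.lift.symm v)).2 hc
      rwa [Equiv.apply_symm_apply] at this
  · rintro ⟨w, ⟨hw, hnc⟩, rfl⟩
    exact ⟨(φ.mem_insertNone_iff w).2 hw, fun hc => hnc ((φ.cconn_ctransport m b w).1 hc)⟩

/-- **Invariance of the pair sums**: for invariant couplings, transported sources and a
functional `F'` that on transported configurations agrees with `F`,
`∑_{∂n₁ = φX, ∂n₂ = φY} w w F'(n₁+n₂) = ∑_{∂n₁ = X, ∂n₂ = Y} w w F(n₁+n₂)`. [folklore] -/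
theorem VolAut.currentPairSum_map {θ : Sym2 (Option V) → ℝ} (hθ : ∀ e : Eg, θ (Sym2.map φ.lift e) = θ e)
    (X Y : Finset (Option V)) {F F' : (Eg → ℕ) → ℝ≥0∞} (hF : ∀ m, F' (φ.ctransport m) = F m) :
    currentPairSum G Λ θ (X.map φ.liftEmb) (Y.map φ.liftEmb) F' = currentPairSum G Λ θ X Y F := by
  unfold currentPairSum
  rw [← (Equiv.prodCongr φ.ctransport φ.ctransport).tsum_eq]
  refine tsum_congr fun p => ?_
  simp only [Equiv.prodCongr_apply, Prod.map_fst, Prod.map_snd]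
  have hsrc : ∀ (n : Eg → ℕ) (Z : Finset (Option V)),
      (∂g (φ.ctransport n) = Z.map φ.liftEmb ∧ CSupp Gg Λg Eg (φ.ctransport n)) ↔ (∂g n = Z ∧ CSupp Gg Λg Eg n) := by
    intro n Z
    rw [φ.csources_ctransport]
    exact ⟨fun h => ⟨Finset.map_injective _ h.1, csupp_edgesIn n⟩, fun h => ⟨by rw [h.1], csupp_edgesIn _⟩⟩
  rw [ind_congr (hsrc p.1 X), ind_congr (hsrc p.2 Y), φ.gweight_ctransport hθ, φ.gweight_ctransport hθ,
    ← φ.ctransport_add, hF]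

/-- **Invariance of the law of `𝒮_g`**: `W(φ S') = W(S')` for the weight
`W(S') = ∑_{∂n₁=∂n₂=∅} w w 𝟙[𝒮_g = S']` (Duminil-Copin–Tassion's `𝐏⊗𝐏(𝒮_g = S)`, unnormalised). [folklore] -/
theorem VolAut.dctW_map {θ : Sym2 (Option V) → ℝ} (hθ : ∀ e : Eg, θ (Sym2.map φ.lift e) = θ e) (S' : Finset V) :
    dctW G Λ θ (S'.map φ.toEquiv.toEmbedding) = dctW G Λ θ S' := by
  unfold dctW
  have hmap : (S'.map φ.toEquiv.toEmbedding).map Function.Embedding.some = (S'.map Function.Embedding.some).map φ.liftEmb := by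
    rw [Finset.map_map, Finset.map_map]
    congr 1
  rw [hmap]
  have h0 : (∅ : Finset (Option V)) = (∅ : Finset (Option V)).map φ.liftEmb := (Finset.map_empty _).symm
  conv_lhs => rw [h0]
  refine φ.currentPairSum_map hθ ∅ ∅ fun m => ind_congr ?_
  have hcl : 𝒮[φ.ctransport m, none] = (𝒮[m, none]).map φ.liftEmb := φ.clusterCompl_ctransport m none
  rw [hcl]
  exact ⟨fun h => Finset.map_injective _ h, fun h => by rw [h]⟩

end Transport

/-! ### The torus: translations -/

section Torus

variable {d L : ℕ} [NeZero L]

/-- **Translations of the discrete torus** are volume-preserving automorphisms of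
`(torusGraph d L, univ)`. [cite: FriedliVelenik2017, §3.1 (periodic boundary condition)] -/
def torusTranslate (a : TorusSite d L) : VolAut (torusGraph d L) (Finset.univ : Finset (TorusSite d L)) where
  toEquiv := Equiv.addRight a
  adj_iff x y := torusGraph_adj_add_right a x y
  mem_iff x := by simp

/-- `torusTranslate a` acts by `x ↦ x + a`. [folklore] -/
@[simp] theorem torusTranslate_apply (a x : TorusSite d L) : (torusTranslate a).toEquiv x = x + a := rfl

/-- The uniform couplings `β`, `βh` on the ghost graph are translation invariant. [folklore] -/
theorem ghostCoupling_map_torusTranslate (β k : ℝ) (a : TorusSite d L)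
    (e : edgesIn (ghostGraph (torusGraph d L) (Finset.univ : Finset (TorusSite d L))) (Finset.insertNone Finset.univ)) :
    ghostCoupling β k (Sym2.map (torusTranslate a).lift e) = ghostCoupling β k (e : Sym2 (Option (TorusSite d L))) := by
  unfold ghostCoupling
  have hiff : ((none : Option (TorusSite d L)) ∈ Sym2.map (torusTranslate a).lift (e : Sym2 (Option (TorusSite d L)))) ↔
      ((none : Option (TorusSite d L)) ∈ (e : Sym2 (Option (TorusSite d L)))) := by
    simpa using (torusTranslate a).lift_mem_map_iff none e
  simp only [hiff]

/-- **Translation invariance of the law of `𝒮_g` on the torus**: `W(S' + a) = W(S')` for the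
duplicated sourceless random currents of the periodic Ising model in a field (the invariance
behind Aizenman–Fernández's (5.12) for current-defined translation-invariant functions). [cite: AizenmanFernandezJSP1986, §5.1, eq. (5.12) and proof of Lemma 5.3, p. 427] -/
theorem dctW_torus_add (β k : ℝ) (a : TorusSite d L) (S' : Finset (TorusSite d L)) :
    dctW (torusGraph d L) Finset.univ (ghostCoupling β k) (S'.map (Equiv.addRight a).toEmbedding) =
      dctW (torusGraph d L) Finset.univ (ghostCoupling β k) S' :=
  (torusTranslate a).dctW_map (ghostCoupling_map_torusTranslate β k a) S'

end Torus

end Literature.Probability.LatticeModels
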